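import Summits.QuantumFields.YangMills.Theorems.LuscherReductionRunningReductionAxialGauge
import HarnessLib

/-!
# The axial kernel is invariant under the residual global `SU(2)`: `A_β(k w k⁻¹, k w' k⁻¹) = A_β(w, w')` (fixed-lattice programme COARSE(L₀) — route
# `LuscherReduction`, crux RED stmt-QuantumFields-19978 KT-door 3b′ / crux `TwistedTraceScaling` stmt-QuantumFields-20203 S-BASE; design note
# `pub/ym-fleet/ym-luscher-20007-p1/COARSE-DESIGN.md` §10–§11)

The comb gauge leaves a residual global gauge freedom (rotation at the root); on the non-tree links it acts by simultaneous conjugation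
`w ↦ k w k⁻¹`.  This file proves that the axial kernel (`…AxialGauge`) is invariant under it:
* `extOne_conj`, `treeGauge_extOne_conj` — conjugating the tree data conjugates the comb transporters;
* `recon_conj` — `recon (t, k w' k⁻¹) = (recon (k⁻¹ t k, w'))^{k}` (constant gauge transformation), `glue_conj'` — `glue (k w k⁻¹) = (glue w)^{k}`;
* `measurePreserving_conjTree` — `t ↦ k⁻¹ t k` preserves `Haar^{tree}`;
* ★ `axialKernel_conj : axialKernel β (k w k⁻¹) (k w' k⁻¹) = axialKernel β w w'` (gauge invariance of `K_β` + change of variables in `t`).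
So the axial spectral problem carries an exact `SU(2)` symmetry; `Ad`-invariant function classes (`…AxialSchur`, `…ValleyAxial`) are the natural domain.
HONEST FRAMING: bookkeeping; femto rung R2b1; not infinite volume, not a gap, not Clay.
-/

set_option autoImplicit false

noncomputable section

open MeasureTheory Filter Topology Real
open scoped Matrix ComplexConjugate BigOperators
open Literature.MathematicalPhysics.QuantumFieldTheory
open Literature.MathematicalPhysics.QuantumLattice

namespace Summit.QuantumFields.YangMills.Theorems.FemtoTransferGap

variable {L : ℕ} [NeZero L]

/-! ## §1 Conjugating the tree data -/

omit [NeZero L] in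
/-- Extension by `1` commutes with conjugation: `extOne (k t k⁻¹) = (extOne t)^{k}`. [folklore] -/
theorem extOne_conj (k : SU2) (t : TreeIdx L → SU2) :
    extOne (fun i : TreeIdx L => k * t i * k⁻¹) = gaugeTransform (fun _ : Site 3 L => k) (extOne t) := by
  funext e
  rw [gaugeTransform_const_apply]
  unfold extOne
  rw [splitEquiv_symm_apply, splitEquiv_symm_apply]
  by_cases he : treeEdge e = true
  · rw [dif_pos he, dif_pos he]
  · rw [dif_neg he, dif_neg he, mul_one, mul_inv_cancel]

/-- The comb transporters of conjugated tree data are conjugated. [folklore] -/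
theorem treeGauge_extOne_conj (k : SU2) (t : TreeIdx L → SU2) (x : Site 3 L) :
    treeGauge (extOne fun i : TreeIdx L => k * t i * k⁻¹) x = k * treeGauge (extOne t) x * k⁻¹ := by
  rw [extOne_conj, treeGauge_gaugeTransform]

/-- ★ `recon (t, k w' k⁻¹) = (recon (k⁻¹ t k, w'))^{k}`. [folklore] -/
theorem recon_conj (k : SU2) (t : TreeIdx L → SU2) (w' : OffIdx L → SU2) :
    recon (t, fun i : OffIdx L => k * w' i * k⁻¹) =
      gaugeTransform (fun _ : Site 3 L => k) (recon (fun i : TreeIdx L => k⁻¹ * t i * k, w')) := by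
  funext e
  rw [gaugeTransform_const_apply]
  by_cases he : treeEdge e = true
  · rw [recon_apply_of_tree _ he, recon_apply_of_tree _ he]
    group
  · rw [recon_apply_of_not_tree _ he, recon_apply_of_not_tree _ he]
    simp only
    rw [show (fun i : TreeIdx L => k⁻¹ * t i * k) = fun i => k⁻¹ * t i * k⁻¹⁻¹ by simp only [inv_inv],
      treeGauge_extOne_conj, treeGauge_extOne_conj]
    simp only [inv_inv, mul_inv_rev]
    group

omit [NeZero L] in
/-- `glue (k w k⁻¹) = (glue w)^{k}`. [folklore] -/
theorem glue_conj' (k : SU2) (w : OffIdx L → SU2) :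
    glue (fun i : OffIdx L => k * w i * k⁻¹) = gaugeTransform (fun _ : Site 3 L => k) (glue w) := by
  funext e
  rw [gaugeTransform_const_apply]
  by_cases he : treeEdge e = true
  · rw [glue_apply_of_tree _ he, glue_apply_of_tree _ he, mul_one, mul_inv_cancel]
  · rw [glue_apply_of_not_tree _ he, glue_apply_of_not_tree _ he]

/-! ## §2 Invariance of the axial kernel -/

/-- Conjugation of the tree data preserves `Haar^{tree}`. [folklore] -/
theorem measurePreserving_conjTree (k : SU2) :
    MeasurePreserving (fun t : TreeIdx L → SU2 => fun i => k⁻¹ * t i * k)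
      (Measure.pi fun _ : TreeIdx L => haarProbability SU2) (Measure.pi fun _ : TreeIdx L => haarProbability SU2) :=
  measurePreserving_pi (fun _ : TreeIdx L => haarProbability SU2) (fun _ : TreeIdx L => haarProbability SU2)
    (f := fun (_ : TreeIdx L) (u : SU2) => k⁻¹ * u * k) fun _ => WilsonGauge.measurePreserving_mul_mul _ _

/-- ★★ **The axial kernel is invariant under the residual global `SU(2)`**: `axialKernel β (k w k⁻¹) (k w' k⁻¹) = axialKernel β w w'`.
[cite: SeilerLNP1982, §3] -/
theorem axialKernel_conj (β : ℝ) (k : SU2) (w w' : OffIdx L → SU2) :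
    axialKernel β (fun i : OffIdx L => k * w i * k⁻¹) (fun i : OffIdx L => k * w' i * k⁻¹) = axialKernel β w w' := by
  unfold axialKernel
  have hpt : ∀ t : TreeIdx L → SU2, transferKernel su2Rep β (glue fun i : OffIdx L => k * w i * k⁻¹) (recon (t, fun i : OffIdx L => k * w' i * k⁻¹)) =
      transferKernel su2Rep β (glue w) (recon (fun i : TreeIdx L => k⁻¹ * t i * k, w')) := fun t => by
    rw [glue_conj', recon_conj, transferKernel_gaugeTransform]
  simp_rw [hpt]
  have hF : Measurable fun t : TreeIdx L → SU2 => transferKernel su2Rep β (glue w) (recon (t, w')) :=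
    (measurable_transferKernel_left β (glue w)).comp (measurable_recon.comp (measurable_id.prodMk measurable_const))
  have h := integral_map (μ := Measure.pi fun _ : TreeIdx L => haarProbability SU2) (measurePreserving_conjTree (L := L) k).measurable.aemeasurable
    (f := fun t : TreeIdx L → SU2 => transferKernel su2Rep β (glue w) (recon (t, w'))) hF.aestronglyMeasurable
  rw [(measurePreserving_conjTree (L := L) k).map_eq] at h
  exact h.symm

end Summit.QuantumFields.YangMills.Theorems.FemtoTransferGap

end
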